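import Summits.ResolutionOfSingularities.ResolutionOfSingularities.Theorems.HilbertSamuelEliminationSigmaMaxModificationsCorridor3WLadderStrataNearFibre
import Literature.AlgebraicGeometry.Resolution.SncStrata
import Literature.AlgebraicGeometry.Resolution.BoundarySplitting
import Literature.AlgebraicGeometry.Resolution.AlterationsSectionDivisor
import HarnessLib

/-!
# [OURS · L1 W4.2] The STRATA-half of the MOVING W-ladder, ninth layer (part 2a): the dictionary «regular CURVE at the point» ⟷
# «`dim 𝒪_{X,x}/I(Z)_x ≤ 1`», and a local effective-Cartier criterion — PROVED

Crux chain w42 (`SigmaMaxModifications`, stmt-ResolutionOfSingularities-18506; skeleton `w_ladder` v6/v7 on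
`SigmaMaxModificationsCorridor3`, stmt-ResolutionOfSingularities-19249), row «stub-4 → `Moving.Wlow3CharStrataM p`», kernel (K-str)
`StrataStrictTransformClean` (p516588), seat res-L1-w42-stub-4 (gen 4). OURS (cell res-hironaka, slot W4.2); NOT statements of
H. Hironaka's manuscript [Hironaka2017] nor of [CossartJannsenSaito2020]; AI-drafted, weaker than expert review. Pure proofs (no
definitions); consumed by part 2b (`…Corridor3WLadderStrataStrictTransform`, kernel (K-str) CLOSED). Helper file
`--supports stmt-ResolutionOfSingularities-19249`.

* `ringKrullDim_quotient_le_one_of_curve` / `curve_of_ringKrullDim_quotient_le_one` — for `x ∈ Z` irreducible closed: «every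
  irreducible closed subset of `Z` through `x` is `{x}` or `Z`» (the topological clause of `IsRegularCurveAt`, p516588) ⟺
  `dim 𝒪_{X,x}/I(Z)_x ≤ 1`, by the dictionary «generisations of `x` = primes of `𝒪_{X,x}`» (Stacks 01J7; tree `primeOfSpecializes`,
  `fromSpecStalk_specializes`, p511345 `two_le_ringKrullDim_quotient_stalkIdeal`).
* `isEffectiveCartier_comap_ι_of_ideal_eq_span` — an ideal sheaf generated over an affine open `V` by one nonzerodivisor is an
  effective Cartier divisor on the open subscheme `V` (the local form of the tree's `IsEffectiveCartier.comap_ι`).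
* `nonempty_stalkSubschemeEquiv'` — `𝒪_{V(J),s} ≅ 𝒪_{X,ι s}/J_{ι s}`.

References: Stacks 01J7 [StacksProject]; Görtz–Wedhorn I (13.19) [GortzWedhorn2020]; tree `Literature…SncStrata`, `…Blowups`,
`…BoundarySplitting`, `…AlterationsSectionDivisor`.
-/

noncomputable section

-- plan-1/idea-2 module setting kept (namespace `…Corridor3.Moving` re-enters `…Corridor3`)
set_option linter.dupNamespace false

open CategoryTheory AlgebraicGeometry TopologicalSpace Topology IsLocalRing
open Summit.ResolutionOfSingularities.ResolutionOfSingularities.Theorems.CampaignW42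
open Literature.AlgebraicGeometry.Resolution Literature.RingTheory.HilbertSamuel
open Literature.AlgebraicGeometry.CossartJannsenSaito2020
open Summit.ResolutionOfSingularities.ResolutionOfSingularities.Theorems.SigmaMaxModificationsCorridor3

universe u

namespace Summit.ResolutionOfSingularities.ResolutionOfSingularities.Theorems.SigmaMaxModificationsCorridor3.Moving

variable {R : ∀ S : Scheme.{u}, CentreSeq S → Prop} {N : ℕ} {ν : ℕ → ℕ}

/-! ## §1. Dictionary lemmas -/

/-- **«Curve at `x`» ⇒ `dim 𝒪_{X,x}/I(Z)_x ≤ 1`**: a chain of two primes above `I(Z)_x` gives two generisations of `x` in `Z`, i.e. an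
irreducible closed subset of `Z` strictly between `{x}` and `Z`. [cite: StacksProject, Tag 01J7] -/
theorem ringKrullDim_quotient_le_one_of_curve {X : Scheme.{u}} {Z : Set X} (hZcl : IsClosed Z)
    {x : X} (hcurve : ∀ A : Set X, IsIrreducible A → IsClosed A → x ∈ A → A ⊆ Z → A = {x} ∨ A = Z) :
    ringKrullDim (X.presheaf.stalk x ⧸ stalkIdeal (Scheme.IdealSheafData.vanishingIdeal ⟨Z, hZcl⟩) x) ≤ 1 := by
  rw [ringKrullDim_quotient, Order.krullDim]
  refine iSup_le fun l => ?_
  by_contra hl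
  have h2 : 2 ≤ l.length := by
    by_contra h2
    exact hl (by exact_mod_cast (show l.length ≤ 1 by omega))
  -- three primes `q₀ < q₁ < q₂` above `I(Z)_x`
  let i₀ : Fin (l.length + 1) := ⟨0, by omega⟩
  let i₁ : Fin (l.length + 1) := ⟨1, by omega⟩
  let i₂ : Fin (l.length + 1) := ⟨2, by omega⟩
  have h01 : l i₀ < l i₁ := l.strictMono (Fin.mk_lt_mk.mpr (by omega))
  have h12 : l i₁ < l i₂ := l.strictMono (Fin.mk_lt_mk.mpr (by omega))
  set q₀ := (l i₀).1 with hq₀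
  set q₁ := (l i₁).1 with hq₁
  set q₂ := (l i₂).1 with hq₂
  have hJ₀ : stalkIdeal (Scheme.IdealSheafData.vanishingIdeal ⟨Z, hZcl⟩) x ≤ q₀.asIdeal := by
    have := (l i₀).2; rwa [PrimeSpectrum.mem_zeroLocus, SetLike.coe_subset_coe] at this
  have hJ₁ : stalkIdeal (Scheme.IdealSheafData.vanishingIdeal ⟨Z, hZcl⟩) x ≤ q₁.asIdeal := by
    have := (l i₁).2; rwa [PrimeSpectrum.mem_zeroLocus, SetLike.coe_subset_coe] at this
  -- the generisations `y₀ ⤳ y₁ ⤳ x` they define, all in `Z`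
  have hy₀ := fromSpecStalk_specializes (X := X) (t := x) q₀
  have hy₁ := fromSpecStalk_specializes (X := X) (t := x) q₁
  have hp₀ : primeOfSpecializes hy₀ = q₀.asIdeal := primeOfSpecializes_fromSpecStalk q₀
  have hp₁ : primeOfSpecializes hy₁ = q₁.asIdeal := primeOfSpecializes_fromSpecStalk q₁
  have hy₀Z : X.fromSpecStalk x q₀ ∈ (⟨Z, hZcl⟩ : Closeds X) :=
    (mem_iff_stalkIdeal_vanishingIdeal_le hy₀).mpr (hp₀ ▸ hJ₀)
  have hy₁Z : X.fromSpecStalk x q₁ ∈ (⟨Z, hZcl⟩ : Closeds X) :=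
    (mem_iff_stalkIdeal_vanishingIdeal_le hy₁).mpr (hp₁ ▸ hJ₁)
  have hy₀₁ : X.fromSpecStalk x q₀ ⤳ X.fromSpecStalk x q₁ :=
    specializes_of_primeOfSpecializes_le hy₁ hy₀ (by rw [hp₀, hp₁]; exact h01.le)
  -- a prime strictly below another is not maximal: `y₁ ≠ x`, `y₀ ≠ y₁`
  have hne₁ : X.fromSpecStalk x q₁ ≠ x := by
    intro h
    have hmax : q₁.asIdeal = maximalIdeal _ := by
      rw [← hp₁]
      have : primeOfSpecializes hy₁ = primeOfSpecializes (specializes_refl x) := by congr 1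
      rw [this, Literature.AlgebraicGeometry.Resolution.primeOfSpecializes_refl]
    have hlt : q₁.asIdeal < q₂.asIdeal := h12
    exact hlt.ne (le_antisymm hlt.le (hmax ▸ le_maximalIdeal q₂.2.ne_top))
  have hne₀₁ : X.fromSpecStalk x q₀ ≠ X.fromSpecStalk x q₁ := by
    intro h
    have : q₀ = q₁ := (X.fromSpecStalk x).isEmbedding.injective h
    exact h01.ne (Subtype.ext this)
  -- `A = closure {y₁}` is an irreducible closed subset of `Z` through `x`: `{x}` or `Z` — both absurd
  set A := closure ({X.fromSpecStalk x q₁} : Set X) with hA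
  have hAgen : IsGenericPoint (X.fromSpecStalk x q₁) A := isGenericPoint_closure
  have hy₁A : X.fromSpecStalk x q₁ ∈ A := subset_closure (Set.mem_singleton _)
  rcases hcurve A isIrreducible_singleton.closure isClosed_closure (hAgen.specializes_iff_mem.mp hy₁)
    (closure_minimal (Set.singleton_subset_iff.mpr hy₁Z) hZcl) with hAx | hAZ
  · apply hne₁
    rw [hAx] at hy₁A
    exact hy₁A
  · -- then `y₁` is the generic point of `Z`, and `y₀ ∈ Z` generises it: `y₀ = y₁`
    apply hne₀₁
    have h1 : X.fromSpecStalk x q₁ ⤳ X.fromSpecStalk x q₀ := hAgen.specializes (by rw [hAZ]; exact hy₀Z)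
    exact (hy₀₁.antisymm h1).eq


/-- **`dim 𝒪_{X,x}/I(Z)_x ≤ 1` ⇒ «curve at `x`»**: an irreducible closed `A` with `{x} ⊊ A ⊊ Z` gives the chain of generisations
`η_Z ⤳ η_A ⤳ x` in `Z`, hence `2 ≤ dim` (p511345 `two_le_ringKrullDim_quotient_stalkIdeal`). [cite: StacksProject, Tag 01J7] -/
theorem curve_of_ringKrullDim_quotient_le_one {X : Scheme.{u}} {Z : Set X} (hZirr : IsIrreducible Z) (hZcl : IsClosed Z)
    {x : X} (hx : IsClosed ({x} : Set X))
    (hdim : ringKrullDim (X.presheaf.stalk x ⧸ stalkIdeal (Scheme.IdealSheafData.vanishingIdeal ⟨Z, hZcl⟩) x) ≤ 1) :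
    ∀ A : Set X, IsIrreducible A → IsClosed A → x ∈ A → A ⊆ Z → A = {x} ∨ A = Z := by
  intro A hAirr hAcl hxA hAZ
  by_contra hnot
  push Not at hnot
  obtain ⟨hAx, hAZ'⟩ := hnot
  have hAgen : IsGenericPoint hAirr.genericPoint A := hAirr.isGenericPoint_genericPoint hAcl
  have hZgen : IsGenericPoint hZirr.genericPoint Z := hZirr.isGenericPoint_genericPoint hZcl
  set a := hAirr.genericPoint
  set η := hZirr.genericPoint
  have hax : a ⤳ x := hAgen.specializes hxA
  have hηa : η ⤳ a := hZgen.specializes (hAZ hAgen.mem)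
  have hne₁ : a ≠ x := by
    intro h; apply hAx; rw [← hAgen.def, h, hx.closure_eq]
  have hne₂ : η ≠ a := by
    intro h; apply hAZ'; rw [← hAgen.def, ← hZgen.def, h]
  have hηI : η ∈ (Scheme.IdealSheafData.vanishingIdeal (⟨Z, hZcl⟩ : Closeds X)).support := by
    rw [← SetLike.mem_coe, coe_support_vanishingIdeal]; exact hZgen.mem
  have haI : a ∈ (Scheme.IdealSheafData.vanishingIdeal (⟨Z, hZcl⟩ : Closeds X)).support := by
    rw [← SetLike.mem_coe, coe_support_vanishingIdeal]; exact hAZ hAgen.mem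
  have h2 := two_le_ringKrullDim_quotient_stalkIdeal _ hax hηa hne₁ hne₂ hηI haI
  have h21 : (2 : WithBot ℕ∞) ≤ 1 := h2.trans hdim
  exact absurd h21 (by decide)

/-- **An ideal sheaf generated over an affine open `V` by one nonzerodivisor is an effective Cartier divisor on the open subscheme
`V`** (the local form of `IsEffectiveCartier.comap_ι`). [cite: GortzWedhorn2020, (13.19) p. 413] -/
theorem isEffectiveCartier_comap_ι_of_ideal_eq_span {X : Scheme.{u}} {I : X.IdealSheafData} (V : X.affineOpens)
    {g : Γ(X, V)} (hg : g ∈ nonZeroDivisors Γ(X, V)) (hIV : I.ideal V = Ideal.span {g}) :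
    IsEffectiveCartier (I.comap (V : X.Opens).ι) := by
  intro u
  obtain ⟨W, hW, huW, hWV⟩ :=
    exists_isAffineOpen_mem_and_subset (X := (V : X.Opens)) (x := u) (U := (V : X.Opens).ι ⁻¹ᵁ (V : X.Opens))
      (by change (V : X.Opens).ι u ∈ (V : X.Opens); exact u.2)
  have hB : IsAffineOpen ((V : X.Opens).ι ''ᵁ W) := hW.image_of_isOpenImmersion (V : X.Opens).ι
  have hBV : (V : X.Opens).ι ''ᵁ W ≤ (V : X.Opens) := by
    rintro x ⟨w, hw, rfl⟩
    exact hWV hw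
  set g' : Γ(X, (V : X.Opens).ι ''ᵁ W) := X.presheaf.map (homOfLE hBV).op g with hg'def
  have hg' : g' ∈ nonZeroDivisors Γ(X, (V : X.Opens).ι ''ᵁ W) :=
    map_mem_nonZeroDivisors_of_le (U := ⟨_, hB⟩) (V := V) hBV hg
  have hIB : I.ideal ⟨(V : X.Opens).ι ''ᵁ W, hB⟩ = Ideal.span {g'} := by
    rw [← I.map_ideal (U := ⟨_, hB⟩) (V := V) hBV, hIV, Ideal.map_span, Set.image_singleton]
    rfl
  let e := (V : X.Opens).ι.appIso W
  refine ⟨⟨W, hW⟩, huW, e.hom.hom g', ?_, ?_⟩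
  · rw [mem_nonZeroDivisors_iff_right]
    intro x hx
    have hx' : e.inv.hom x * g' = 0 := by
      have := congrArg e.inv.hom hx
      rwa [map_mul, map_zero, ← CommRingCat.comp_apply, e.hom_inv_id] at this
    have := (mem_nonZeroDivisors_iff_right.mp hg') _ hx'
    calc x = e.hom.hom (e.inv.hom x) := by rw [← CommRingCat.comp_apply, e.inv_hom_id]; rfl
      _ = 0 := by rw [this, map_zero]
  · rw [Scheme.IdealSheafData.ideal_comap_of_isOpenImmersion]
    change (I.ideal ⟨(V : X.Opens).ι ''ᵁ W, hB⟩).comap e.inv.hom = _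
    rw [hIB]
    apply le_antisymm
    · intro x hx
      rw [Ideal.mem_comap, Ideal.mem_span_singleton] at hx
      obtain ⟨a, ha⟩ := hx
      rw [Ideal.mem_span_singleton]
      refine ⟨e.hom.hom a, ?_⟩
      calc x = e.hom.hom (e.inv.hom x) := by rw [← CommRingCat.comp_apply, e.inv_hom_id]; rfl
        _ = e.hom.hom g' * e.hom.hom a := by rw [ha, map_mul]
    · rw [Ideal.span_singleton_le_iff_mem, Ideal.mem_comap, ← CommRingCat.comp_apply, e.hom_inv_id]
      exact Ideal.mem_span_singleton_self g'


/-- The local rings of a closed subscheme `V(J)` are the quotient stalks `𝒪_{X,ι s}/J_{ι s}` (a ring isomorphism exists; cf.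
`isRegularLocalRing_stalk_subscheme_iff`). [folklore] -/
theorem nonempty_stalkSubschemeEquiv' {X : Scheme.{u}} (J : X.IdealSheafData) (s : J.subscheme) :
    Nonempty ((X.presheaf.stalk (J.subschemeι.base s) ⧸ stalkIdeal J (J.subschemeι.base s)) ≃+*
      J.subscheme.presheaf.stalk s) := by
  have hker : RingHom.ker (J.subschemeι.stalkMap s).hom = stalkIdeal J (J.subschemeι.base s) := by
    rw [← stalkIdeal_ker_eq_ker_stalkMap J.subschemeι s, Scheme.IdealSheafData.ker_subschemeι]
  exact ⟨(Ideal.quotEquivOfEq hker.symm).trans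
    (RingHom.quotientKerEquivOfSurjective (J.subschemeι.stalkMap_surjective s))⟩

end Summit.ResolutionOfSingularities.ResolutionOfSingularities.Theorems.SigmaMaxModificationsCorridor3.Moving

end
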